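import Summits.Ventures.PercRepro.S1FiveCircuitsSolidSixGen

/-!
# PercRepro — CASE 1 AT NULLITY `6` BY DELETION AND AVERAGING: `≤ max 40 (q₅ + 15)`, AND `s₅ ≤ 146` ON THE `(13, 7)` CORE MODULO THE TABLE
(p1, gen 33)

`proofs/P1-S2-CORANK6.md` §4l addendum 7. On a spread e-free core of nullity `6` with a 7-point rank-`4` flat `S₀` through `e`:
* if some point `s ∈ S₀ ∖ {e}` is a coloop, the circuits inside `S₀` avoid it (`≤ C(5, 4) = 5`), and with class (α) `≤ 15`, class (β) `≤ 20`
  (`S1FiveCircuitsSolidSix`, `d' = 3`) the total is `≤ 40`;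
* otherwise every `s ∈ S₀ ∖ {e}` lies on a circuit; DOUBLE COUNTING the pairs `(C, s)` with `s ∈ C ∩ (S₀ ∖ {e})`
  (`Finset.sum_card_bipartiteAbove_eq_sum_card_bipartiteBelow`): a circuit inside `S₀` contributes `4`, one outside at most `1`
  (`ncard_inter_le_two_of_not_subset`), so the six degrees sum to `≤ 4·15 + 35 = 95` and some `s` has degree `≤ 15`
  (`Finset.exists_lt_of_sum_lt`); deleting it (`nullity_delete_singleton_of_not_isColoop`, `hfree_delete`, `spread_delete`) leaves a spread
  e-free core of nullity `5`, whose five-circuits through `e` number `≤ q₅` — any per-point cap at nullity `5` — and the circuits through `s`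
  number `≤ 15` (`ncard_fiveCircuitsThrough_le_delete_add`).
**`ncard_fiveCircuitsThrough_le_of_seven_solid_six_of_five`**: `≤ max 40 (q₅ + 15)`. With `q₅ = max 28 (capSum t 5)` (the nullity-`5` skeleton on
`M ＼ {s}`): **`ncard_fiveCircuits_le_one_forty_six_thirteen_seven_of_tPoorSix`** — `s₅ ≤ 146` on the `(13, 7)` coloop-free spread e-free core
MODULO THE PLANE-POOR 8-SPREAD TABLE AT NULLITIES `3 … 6` ALONE (`⌊20·(21 + 18 + 28 + 43)/15⌋ = 146 ≤ 150`, p7 g16's target). Nothing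
about any cell is claimed. Axioms: standard.
-/

open scoped Matroid

namespace PercRepro

namespace S1

open Set

open FourCap

variable {α : Type}

/-- **The deletion split**: the five-circuits through `e` of `M` are those of `M ＼ {s}` and those through `s`. -/
theorem ncard_fiveCircuitsThrough_le_delete_add (M : Matroid α) [M.Finite] (e s : α) :
    {C : Set α | M.IsCircuit C ∧ C.ncard = 5 ∧ e ∈ C}.ncard ≤
      {C : Set α | (M ＼ {s}).IsCircuit C ∧ C.ncard = 5 ∧ e ∈ C}.ncard +
        {C : Set α | M.IsCircuit C ∧ C.ncard = 5 ∧ e ∈ C ∧ s ∈ C}.ncard := by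
  classical
  have hsub : {C : Set α | M.IsCircuit C ∧ C.ncard = 5 ∧ e ∈ C} ⊆
      {C : Set α | (M ＼ {s}).IsCircuit C ∧ C.ncard = 5 ∧ e ∈ C} ∪
        {C : Set α | M.IsCircuit C ∧ C.ncard = 5 ∧ e ∈ C ∧ s ∈ C} := by
    rintro C ⟨hC, h5, heC⟩
    by_cases hs : s ∈ C
    · exact Or.inr ⟨hC, h5, heC, hs⟩
    · exact Or.inl ⟨Matroid.delete_isCircuit_iff.2 ⟨hC, disjoint_singleton_right.2 hs⟩, h5, heC⟩
  have hfin1 : {C : Set α | (M ＼ {s}).IsCircuit C ∧ C.ncard = 5 ∧ e ∈ C}.Finite :=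
    (M ＼ {s}).ground_finite.finite_subsets.subset (fun C hC => hC.1.subset_ground)
  have hfin2 : {C : Set α | M.IsCircuit C ∧ C.ncard = 5 ∧ e ∈ C ∧ s ∈ C}.Finite :=
    M.ground_finite.finite_subsets.subset (fun C hC => hC.1.subset_ground)
  exact (ncard_le_ncard hsub (hfin1.union hfin2)).trans (ncard_union_le _ _)

/-- **Deleting a non-coloop lowers the nullity by one** (p3's `dual_eRank_delete_singleton_add_one` on the dual). -/
theorem nullity_delete_singleton_of_not_isColoop (M : Matroid α) [M.Finite] {s : α} (hs : s ∈ M.E)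
    (hnc : ¬ M.IsColoop s) {d : ℕ} (hd : M.E.encard = M.eRank + (d + 1)) :
    (M ＼ {s}).E.encard = (M ＼ {s}).eRank + d := by
  have hν : M✶.eRank = ((d + 1 : ℕ) : ℕ∞) := by
    have h := _root_.Matroid.eRank_add_eRank_dual M
    rw [hd] at h
    exact WithTop.add_left_cancel (PercRepro.Matroid.eRank_ne_top_of_finite M) h
  have hdel := PercRepro.Matroid.dual_eRank_delete_singleton_add_one hs hnc
  rw [hν] at hdel
  have hfin' : (M ＼ {s})✶.eRank ≠ ⊤ := by
    intro h
    rw [h, top_add] at hdel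
    exact absurd hdel.symm (ENat.coe_ne_top _)
  obtain ⟨d', hd'⟩ := ENat.ne_top_iff_exists.1 hfin'
  have hdd' : d = d' := by
    rw [← hd'] at hdel
    have : d' + 1 = d + 1 := by exact_mod_cast hdel
    omega
  subst hdd'
  have h := _root_.Matroid.eRank_add_eRank_dual (M ＼ {s})
  rw [← hd'] at h
  exact h.symm

/-- **CASE 1 AT NULLITY `6` BY DELETION AND AVERAGING**: `≤ max 40 (q₅ + 15)` five-circuits through `e`, where `q₅` bounds the five-circuits
through any point of any spread e-free core of nullity `5`. -/
theorem ncard_fiveCircuitsThrough_le_of_seven_solid_six_of_five (M : Matroid α) [M.Finite]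
    (hfree : ∀ e ∈ M.E, ∃ A ⊆ M.E \ {e}, e ∉ M.closure A ∧ e ∉ M.closure ((M.E \ {e}) \ A))
    (hns : ¬ ∃ W ⊆ M.E, W.ncard ≤ 9 ∧ W.encard = M.eRk W + 4) (hd : M.E.encard = M.eRank + 6)
    {e : α} {X : Set α} (hX4 : M.eRk X = 4) (heX : e ∈ M.closure X) (h7 : (M.closure X).ncard = 7) (q₅ : ℕ)
    (hq₅ : ∀ (M' : Matroid α) [M'.Finite],
      (∀ e ∈ M'.E, ∃ A ⊆ M'.E \ {e}, e ∉ M'.closure A ∧ e ∉ M'.closure ((M'.E \ {e}) \ A)) →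
      (¬ ∃ W ⊆ M'.E, W.ncard ≤ 9 ∧ W.encard = M'.eRk W + 4) → M'.E.encard = M'.eRank + 5 → ∀ e' ∈ M'.E,
      {C : Set α | M'.IsCircuit C ∧ C.ncard = 5 ∧ e' ∈ C}.ncard ≤ q₅) :
    {C : Set α | M.IsCircuit C ∧ C.ncard = 5 ∧ e ∈ C}.ncard ≤ max 40 (q₅ + 15) := by
  classical
  have hS₀E : M.closure X ⊆ M.E := M.closure_subset_ground X
  have hS₀f : (M.closure X).Finite := M.ground_finite.subset hS₀E
  have heE : e ∈ M.E := hS₀E heX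
  have hS₀e : (M.closure X \ {e}).ncard = 6 := by rw [ncard_sdiff_singleton_of_mem heX, h7]
  have hd3 : M.E.encard = M.eRank + (3 + 3) := by rw [hd]; norm_num
  have hfinsub : ∀ s : Set (Set α), (∀ C ∈ s, M.IsCircuit C) → s.Finite := fun s hs =>
    M.ground_finite.finite_subsets.subset (fun C hC => (hs C hC).subset_ground)
  -- the three classes
  have hα := ncard_fiveCircuitsThrough_inter_subset_le_choose_gen M 3 hfree hd3 hX4 heX h7
  have hβ := ncard_fiveCircuitsThrough_inter_pair_le_gen M 3 hfree hns hd3 hX4 heX h7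
  have hα' : {C : Set α | M.IsCircuit C ∧ C.ncard = 5 ∧ e ∈ C ∧ C ∩ M.closure X ⊆ {e}}.ncard ≤ 15 :=
    hα.trans (le_of_eq (by decide))
  have hβ' : {C : Set α | M.IsCircuit C ∧ C.ncard = 5 ∧ e ∈ C ∧ ¬ C ⊆ M.closure X ∧
      ¬ C ∩ M.closure X ⊆ {e}}.ncard ≤ 20 := hβ.trans (le_of_eq (by decide))
  have hsplit : {C : Set α | M.IsCircuit C ∧ C.ncard = 5 ∧ e ∈ C} ⊆
      ({C : Set α | M.IsCircuit C ∧ C.ncard = 5 ∧ e ∈ C ∧ C ⊆ M.closure X} ∪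
        {C : Set α | M.IsCircuit C ∧ C.ncard = 5 ∧ e ∈ C ∧ C ∩ M.closure X ⊆ {e}}) ∪
        {C : Set α | M.IsCircuit C ∧ C.ncard = 5 ∧ e ∈ C ∧ ¬ C ⊆ M.closure X ∧ ¬ C ∩ M.closure X ⊆ {e}} := by
    intro C hC
    by_cases h1 : C ⊆ M.closure X
    · exact Or.inl (Or.inl ⟨hC.1, hC.2.1, hC.2.2, h1⟩)
    by_cases h2 : C ∩ M.closure X ⊆ {e}
    · exact Or.inl (Or.inr ⟨hC.1, hC.2.1, hC.2.2, h2⟩)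
    · exact Or.inr ⟨hC.1, hC.2.1, hC.2.2, h1, h2⟩
  have hin15 : {C : Set α | M.IsCircuit C ∧ C.ncard = 5 ∧ e ∈ C ∧ C ⊆ M.closure X}.ncard ≤ 15 := by
    have := ncard_fiveCircuitsThrough_subset_le_choose M hS₀E e
    rw [hS₀e] at this
    exact this.trans (le_of_eq (by decide))
  have htot : {C : Set α | M.IsCircuit C ∧ C.ncard = 5 ∧ e ∈ C}.ncard ≤
      {C : Set α | M.IsCircuit C ∧ C.ncard = 5 ∧ e ∈ C ∧ C ⊆ M.closure X}.ncard +
        {C : Set α | M.IsCircuit C ∧ C.ncard = 5 ∧ e ∈ C ∧ C ∩ M.closure X ⊆ {e}}.ncard +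
        {C : Set α | M.IsCircuit C ∧ C.ncard = 5 ∧ e ∈ C ∧ ¬ C ⊆ M.closure X ∧ ¬ C ∩ M.closure X ⊆ {e}}.ncard := by
    have h1 := ncard_le_ncard hsplit (((hfinsub _ (fun C hC => hC.1)).union (hfinsub _ (fun C hC => hC.1))).union
      (hfinsub _ (fun C hC => hC.1)))
    have h2 := ncard_union_le ({C : Set α | M.IsCircuit C ∧ C.ncard = 5 ∧ e ∈ C ∧ C ⊆ M.closure X} ∪
      {C : Set α | M.IsCircuit C ∧ C.ncard = 5 ∧ e ∈ C ∧ C ∩ M.closure X ⊆ {e}})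
      {C : Set α | M.IsCircuit C ∧ C.ncard = 5 ∧ e ∈ C ∧ ¬ C ⊆ M.closure X ∧ ¬ C ∩ M.closure X ⊆ {e}}
    have h3 := ncard_union_le {C : Set α | M.IsCircuit C ∧ C.ncard = 5 ∧ e ∈ C ∧ C ⊆ M.closure X}
      {C : Set α | M.IsCircuit C ∧ C.ncard = 5 ∧ e ∈ C ∧ C ∩ M.closure X ⊆ {e}}
    omega
  -- CASE A: a coloop inside `S₀ ∖ {e}`: the circuits inside `S₀` avoid it
  by_cases hcol : ∃ s ∈ M.closure X \ {e}, M.IsColoop s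
  · obtain ⟨s, hs, hsc⟩ := hcol
    have hin5 : {C : Set α | M.IsCircuit C ∧ C.ncard = 5 ∧ e ∈ C ∧ C ⊆ M.closure X}.ncard ≤ 5 := by
      have hsub : {C : Set α | M.IsCircuit C ∧ C.ncard = 5 ∧ e ∈ C ∧ C ⊆ M.closure X} ⊆
          {C : Set α | M.IsCircuit C ∧ C.ncard = 5 ∧ e ∈ C ∧ C ⊆ M.closure X \ {s}} := by
        rintro C ⟨hC, h5, heC, hCS⟩
        exact ⟨hC, h5, heC, subset_sdiff.2 ⟨hCS, disjoint_singleton_right.2 (hsc.notMem_isCircuit hC)⟩⟩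
      have h := ncard_fiveCircuitsThrough_subset_le_choose M (sdiff_subset.trans hS₀E) e (S := M.closure X \ {s})
      have h5' : ((M.closure X \ {s}) \ {e}).ncard = 5 := by
        rw [sdiff_sdiff_comm, ncard_sdiff_singleton_of_mem hs, hS₀e]
      rw [h5'] at h
      exact (ncard_le_ncard hsub (hfinsub _ (fun C hC => hC.1))).trans (h.trans (le_of_eq (by decide)))
    have : {C : Set α | M.IsCircuit C ∧ C.ncard = 5 ∧ e ∈ C}.ncard ≤ 40 := by omega
    exact this.trans (le_max_left _ _)
  -- CASE B: every point of `S₀ ∖ {e}` is a non-coloop; average the degrees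
  push Not at hcol
  have hS'f : (M.closure X \ {e}).Finite := hS₀f.subset sdiff_subset
  have h𝒞f : {C : Set α | M.IsCircuit C ∧ C.ncard = 5 ∧ e ∈ C}.Finite := hfinsub _ (fun C hC => hC.1)
  -- the double count: `Σ_C |C ∩ S'| = Σ_s deg(s)`
  have hdc := Finset.sum_card_bipartiteAbove_eq_sum_card_bipartiteBelow (r := fun (C : Set α) (s : α) => s ∈ C)
    (s := h𝒞f.toFinset) (t := hS'f.toFinset)
  -- each circuit contributes `≤ 4` (inside) or `≤ 1` (outside)
  have hrow : ∀ C ∈ h𝒞f.toFinset, (hS'f.toFinset.bipartiteAbove (fun (C : Set α) (s : α) => s ∈ C) C).card ≤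
      if C ⊆ M.closure X then 4 else 1 := by
    intro C hC
    rw [Finite.mem_toFinset] at hC
    have hCf : C.Finite := M.ground_finite.subset hC.1.subset_ground
    have hcoe : ((hS'f.toFinset.bipartiteAbove (fun (C : Set α) (s : α) => s ∈ C) C : Finset α) : Set α) =
        (M.closure X \ {e}) ∩ C := by
      rw [Finset.bipartiteAbove, Finset.coe_filter]
      ext x
      simp only [mem_setOf_eq, Finite.mem_toFinset, mem_inter_iff]
    rw [← ncard_coe_finset, hcoe]
    by_cases hCS : C ⊆ M.closure X
    · rw [if_pos hCS]
      have : (M.closure X \ {e}) ∩ C = C \ {e} := by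
        ext x
        constructor
        · rintro ⟨⟨_, hxe⟩, hxC⟩; exact ⟨hxC, hxe⟩
        · rintro ⟨hxC, hxe⟩; exact ⟨⟨hCS hxC, hxe⟩, hxC⟩
      rw [this, ncard_sdiff_singleton_of_mem hC.2.2, hC.2.1]
    · rw [if_neg hCS]
      have h2 := ncard_inter_le_two_of_not_subset M hns hX4 h7 hC.1 hC.2.1 hCS
      have : (M.closure X \ {e}) ∩ C = (C ∩ M.closure X) \ {e} := by
        ext x
        constructor
        · rintro ⟨⟨hxS, hxe⟩, hxC⟩; exact ⟨⟨hxC, hxS⟩, hxe⟩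
        · rintro ⟨⟨hxC, hxS⟩, hxe⟩; exact ⟨⟨hxS, hxe⟩, hxC⟩
      rw [this, ncard_sdiff_singleton_of_mem (show e ∈ C ∩ M.closure X from ⟨hC.2.2, heX⟩)]
      omega
  have hsum : ∑ s ∈ hS'f.toFinset, (h𝒞f.toFinset.bipartiteBelow (fun (C : Set α) (s : α) => s ∈ C) s).card ≤ 95 := by
    rw [← hdc]
    calc ∑ C ∈ h𝒞f.toFinset, (hS'f.toFinset.bipartiteAbove (fun (C : Set α) (s : α) => s ∈ C) C).card
        ≤ ∑ C ∈ h𝒞f.toFinset, (if C ⊆ M.closure X then 4 else 1) := Finset.sum_le_sum hrow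
      _ = 4 * (h𝒞f.toFinset.filter (fun C => C ⊆ M.closure X)).card +
          (h𝒞f.toFinset.filter (fun C => ¬ C ⊆ M.closure X)).card := by
          rw [Finset.sum_ite, Finset.sum_const, Finset.sum_const, smul_eq_mul, smul_eq_mul, mul_one, mul_comm]
      _ ≤ 4 * 15 + 35 := by
          have hA : (h𝒞f.toFinset.filter (fun C => C ⊆ M.closure X)).card ≤ 15 := by
            rw [← ncard_coe_finset]
            refine (ncard_le_ncard ?_ (hfinsub _ (fun C hC => hC.1))).trans hin15
            intro C hC
            rw [Finset.mem_coe, Finset.mem_filter, Finite.mem_toFinset] at hC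
            exact ⟨hC.1.1, hC.1.2.1, hC.1.2.2, hC.2⟩
          have hB : (h𝒞f.toFinset.filter (fun C => ¬ C ⊆ M.closure X)).card ≤ 35 := by
            rw [← ncard_coe_finset]
            have hsub' : (↑(h𝒞f.toFinset.filter (fun C => ¬ C ⊆ M.closure X)) : Set (Set α)) ⊆
                {C : Set α | M.IsCircuit C ∧ C.ncard = 5 ∧ e ∈ C ∧ C ∩ M.closure X ⊆ {e}} ∪
                  {C : Set α | M.IsCircuit C ∧ C.ncard = 5 ∧ e ∈ C ∧ ¬ C ⊆ M.closure X ∧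
                    ¬ C ∩ M.closure X ⊆ {e}} := by
              intro C hC
              rw [Finset.mem_coe, Finset.mem_filter, Finite.mem_toFinset] at hC
              by_cases h2 : C ∩ M.closure X ⊆ {e}
              · exact Or.inl ⟨hC.1.1, hC.1.2.1, hC.1.2.2, h2⟩
              · exact Or.inr ⟨hC.1.1, hC.1.2.1, hC.1.2.2, hC.2, h2⟩
            have := ncard_le_ncard hsub' ((hfinsub _ (fun C hC => hC.1)).union (hfinsub _ (fun C hC => hC.1)))
            have h' := ncard_union_le {C : Set α | M.IsCircuit C ∧ C.ncard = 5 ∧ e ∈ C ∧ C ∩ M.closure X ⊆ {e}}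
              {C : Set α | M.IsCircuit C ∧ C.ncard = 5 ∧ e ∈ C ∧ ¬ C ⊆ M.closure X ∧ ¬ C ∩ M.closure X ⊆ {e}}
            omega
          omega
      _ = 95 := by norm_num
  -- pigeonhole over the six points of `S₀ ∖ {e}`: some degree is `≤ 15`
  have hcard6 : hS'f.toFinset.card = 6 := by rw [← ncard_eq_toFinset_card _ hS'f, hS₀e]
  have hex : ∃ s ∈ hS'f.toFinset,
      (h𝒞f.toFinset.bipartiteBelow (fun (C : Set α) (s : α) => s ∈ C) s).card < 16 := by
    refine Finset.exists_lt_of_sum_lt ?_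
    rw [Finset.sum_const, hcard6, smul_eq_mul]
    omega
  obtain ⟨s, hs, hdeg⟩ := hex
  rw [Finite.mem_toFinset] at hs
  have hsE : s ∈ M.E := hS₀E hs.1
  have hse : s ≠ e := fun h => hs.2 (mem_singleton_iff.2 h)
  have hdeg' : {C : Set α | M.IsCircuit C ∧ C.ncard = 5 ∧ e ∈ C ∧ s ∈ C}.ncard ≤ 15 := by
    have hcoe : ((h𝒞f.toFinset.bipartiteBelow (fun (C : Set α) (s : α) => s ∈ C) s : Finset (Set α)) : Set (Set α)) =
        {C : Set α | M.IsCircuit C ∧ C.ncard = 5 ∧ e ∈ C ∧ s ∈ C} := by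
      rw [Finset.bipartiteBelow, Finset.coe_filter]
      ext C
      simp only [mem_setOf_eq, Finite.mem_toFinset]
      tauto
    rw [← hcoe, ncard_coe_finset]
    omega
  -- delete `s`: a spread e-free core of nullity `5`
  have hnc : ¬ M.IsColoop s := hcol s hs
  have hd5 : (M ＼ {s}).E.encard = (M ＼ {s}).eRank + 5 :=
    nullity_delete_singleton_of_not_isColoop M hsE hnc (d := 5) (by rw [hd]; norm_num)
  have hfree' := S1.hfree_delete M hfree s
  have hns' := spread_delete M hns s
  have heE' : e ∈ (M ＼ {s}).E := by
    rw [Matroid.delete_ground]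
    exact ⟨heE, fun h => hse (mem_singleton_iff.1 h).symm⟩
  have hq := hq₅ (M ＼ {s}) hfree' hns' hd5 e heE'
  have hsplit' := ncard_fiveCircuitsThrough_le_delete_add M e s
  have : {C : Set α | M.IsCircuit C ∧ C.ncard = 5 ∧ e ∈ C}.ncard ≤ q₅ + 15 := by omega
  exact this.trans (le_max_right _ _)

/-- **`s₅ ≤ 146` ON THE `(13, 7)` CORE MODULO THE PLANE-POOR 8-SPREAD TABLE AT NULLITIES `3 … 6` ALONE** — p7 g16's target `150` met:
`q₄ = 18`, `q₅ = 28`, `q₆ = max 40 (28 + 15) = 43`, `⌊20·(21 + 18 + 28 + 43)/15⌋ = 146`. -/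
theorem ncard_fiveCircuits_le_one_forty_six_thirteen_seven_of_tPoorSix (M : Matroid α) [M.Finite]
    (hfree : ∀ e ∈ M.E, ∃ A ⊆ M.E \ {e}, e ∉ M.closure A ∧ e ∉ M.closure ((M.E \ {e}) \ A))
    (hns : ¬ ∃ W ⊆ M.E, W.ncard ≤ 9 ∧ W.encard = M.eRk W + 4) (hd : M.E.encard = M.eRank + 7)
    (hn : M.E.ncard = 20) (hK : ∀ e, ¬ M.IsColoop e)
    (ht : ∀ (N' : Matroid α) [N'.Finite], PlanePoor N' → Spread8 N' → ∀ j : ℕ, 3 ≤ j → j ≤ 6 →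
      N'.E.encard = N'.eRank + j → ∀ f ∈ N'.E,
      {D : Set α | N'.IsCircuit D ∧ D.ncard = 4 ∧ f ∈ D}.ncard ≤ tPoorSix j) :
    {C : Set α | M.IsCircuit C ∧ C.ncard = 5}.ncard ≤ 146 := by
  have ht' : ∀ (N' : Matroid α) [N'.Finite], PlanePoor N' → Spread8 N' → ∀ j : ℕ, N'.E.encard = N'.eRank + j →
      ∀ f ∈ N'.E, {D : Set α | N'.IsCircuit D ∧ D.ncard = 4 ∧ f ∈ D}.ncard ≤ tPoorSix j := by
    intro N' _ hN' hN8 j hj f hf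
    by_cases hj2 : j ≤ 2
    · have h := tPoor_of_le_two N' hj2 hj f
      have h6 : j ≠ 6 := by omega
      simpa [tPoorSix, h6] using h
    by_cases hj6 : j ≤ 6
    · exact ht N' hN' hN8 j (by omega) hj6 hj f hf
    · refine (ncard_fourCircuitsThrough_le_choose N' hj f).trans (le_of_eq ?_)
      have h0 : j ≠ 0 := by omega
      have h1 : j ≠ 1 := by omega
      have h2 : j ≠ 2 := by omega
      have h3 : j ≠ 3 := by omega
      have h4 : j ≠ 4 := by omega
      have h5 : j ≠ 5 := by omega
      have h6 : j ≠ 6 := by omega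
      simp [tPoorSix, tPoor, h0, h1, h2, h3, h4, h5, h6]
  -- the per-point cap at nullity `5`: `max 28 (capSum tPoorSix 5) = 28`
  have hq₅ : ∀ (M' : Matroid α) [M'.Finite],
      (∀ e ∈ M'.E, ∃ A ⊆ M'.E \ {e}, e ∉ M'.closure A ∧ e ∉ M'.closure ((M'.E \ {e}) \ A)) →
      (¬ ∃ W ⊆ M'.E, W.ncard ≤ 9 ∧ W.encard = M'.eRk W + 4) → M'.E.encard = M'.eRank + 5 → ∀ e' ∈ M'.E,
      {C : Set α | M'.IsCircuit C ∧ C.ncard = 5 ∧ e' ∈ C}.ncard ≤ 28 := by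
    intro M' _ hfree' hns' hd' e' _
    have h := ncard_fiveCircuitsThrough_le_max_of_planePoor_table_five M' hfree' hns' hd' e' tPoorSix ht' 28
      (fun M'' _ hfree'' hns'' hd'' _ _ hX4 heX h7 =>
        ncard_fiveCircuitsThrough_le_twenty_eight_of_seven_solid_five M'' hfree'' hns'' hd'' hX4 heX h7)
    rw [capSum_tPoorSix_five] at h
    exact h.trans (le_of_eq (by decide))
  have h := ncard_fiveCircuits_le_thirteen_seven_of_planePoor_table M hfree hns hd hn hK tPoorSix ht' 43
    (fun M' _ hfree' hns' hd' _ _ hX4 heX h7 =>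
      (ncard_fiveCircuitsThrough_le_of_seven_solid_six_of_five M' hfree' hns' hd' hX4 heX h7 28 hq₅).trans
        (le_of_eq (by decide)))
  rw [capSum_tPoorSix_four, capSum_tPoorSix_five, capSum_tPoorSix_six] at h
  exact h.trans (le_of_eq (by decide))

/-- **The nullity-`7` spread `s₅` cap for ANY point count, modulo the table**: on a coloop-free spread e-free core of nullity `7` on `n > 5`
points, `s₅ ≤ ⌊n·110/(n − 5)⌋` (`146` at `n = 20`, `149` at `19`, `152` at `18`) — for p7's coloop sub-cells `(12, 7)`, `(11, 7)`. -/
theorem ncard_fiveCircuits_le_mul_div_nullity_seven_of_tPoorSix (M : Matroid α) [M.Finite]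
    (hfree : ∀ e ∈ M.E, ∃ A ⊆ M.E \ {e}, e ∉ M.closure A ∧ e ∉ M.closure ((M.E \ {e}) \ A))
    (hns : ¬ ∃ W ⊆ M.E, W.ncard ≤ 9 ∧ W.encard = M.eRk W + 4) (hd : M.E.encard = M.eRank + 7)
    {n : ℕ} (hn : M.E.ncard = n) (hn5 : 5 < n) (hK : ∀ e, ¬ M.IsColoop e)
    (ht : ∀ (N' : Matroid α) [N'.Finite], PlanePoor N' → Spread8 N' → ∀ j : ℕ, 3 ≤ j → j ≤ 6 →
      N'.E.encard = N'.eRank + j → ∀ f ∈ N'.E,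
      {D : Set α | N'.IsCircuit D ∧ D.ncard = 4 ∧ f ∈ D}.ncard ≤ tPoorSix j) :
    {C : Set α | M.IsCircuit C ∧ C.ncard = 5}.ncard ≤ n * 110 / (n - 5) := by
  have ht' : ∀ (N' : Matroid α) [N'.Finite], PlanePoor N' → Spread8 N' → ∀ j : ℕ, N'.E.encard = N'.eRank + j →
      ∀ f ∈ N'.E, {D : Set α | N'.IsCircuit D ∧ D.ncard = 4 ∧ f ∈ D}.ncard ≤ tPoorSix j := by
    intro N' _ hN' hN8 j hj f hf
    by_cases hj2 : j ≤ 2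
    · have h := tPoor_of_le_two N' hj2 hj f
      have h6 : j ≠ 6 := by omega
      simpa [tPoorSix, h6] using h
    by_cases hj6 : j ≤ 6
    · exact ht N' hN' hN8 j (by omega) hj6 hj f hf
    · refine (ncard_fourCircuitsThrough_le_choose N' hj f).trans (le_of_eq ?_)
      have h0 : j ≠ 0 := by omega
      have h1 : j ≠ 1 := by omega
      have h2 : j ≠ 2 := by omega
      have h3 : j ≠ 3 := by omega
      have h4 : j ≠ 4 := by omega
      have h5 : j ≠ 5 := by omega
      have h6 : j ≠ 6 := by omega
      simp [tPoorSix, tPoor, h0, h1, h2, h3, h4, h5, h6]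
  have hq₅ : ∀ (M' : Matroid α) [M'.Finite],
      (∀ e ∈ M'.E, ∃ A ⊆ M'.E \ {e}, e ∉ M'.closure A ∧ e ∉ M'.closure ((M'.E \ {e}) \ A)) →
      (¬ ∃ W ⊆ M'.E, W.ncard ≤ 9 ∧ W.encard = M'.eRk W + 4) → M'.E.encard = M'.eRank + 5 → ∀ e' ∈ M'.E,
      {C : Set α | M'.IsCircuit C ∧ C.ncard = 5 ∧ e' ∈ C}.ncard ≤ 28 := by
    intro M' _ hfree' hns' hd' e' _
    have h := ncard_fiveCircuitsThrough_le_max_of_planePoor_table_five M' hfree' hns' hd' e' tPoorSix ht' 28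
      (fun M'' _ hfree'' hns'' hd'' _ _ hX4 heX h7 =>
        ncard_fiveCircuitsThrough_le_twenty_eight_of_seven_solid_five M'' hfree'' hns'' hd'' hX4 heX h7)
    rw [capSum_tPoorSix_five] at h
    exact h.trans (le_of_eq (by decide))
  have hq₄ : ∀ (M' : Matroid α) [M'.Finite],
      (∀ e ∈ M'.E, ∃ A ⊆ M'.E \ {e}, e ∉ M'.closure A ∧ e ∉ M'.closure ((M'.E \ {e}) \ A)) →
      (¬ ∃ W ⊆ M'.E, W.ncard ≤ 9 ∧ W.encard = M'.eRk W + 4) → M'.E.encard = M'.eRank + 4 → ∀ e' ∈ M'.E,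
      {C : Set α | M'.IsCircuit C ∧ C.ncard = 5 ∧ e' ∈ C}.ncard ≤ 18 := by
    intro M' _ hfree' hns' hd' e' _
    have h := ncard_fiveCircuitsThrough_le_max_of_planePoor_table M' hfree' hns' hd' e' tPoorSix ht'
    rw [capSum_tPoorSix_four] at h
    exact h.trans (le_of_eq (by decide))
  have hq₆ : ∀ (M' : Matroid α) [M'.Finite],
      (∀ e ∈ M'.E, ∃ A ⊆ M'.E \ {e}, e ∉ M'.closure A ∧ e ∉ M'.closure ((M'.E \ {e}) \ A)) →
      (¬ ∃ W ⊆ M'.E, W.ncard ≤ 9 ∧ W.encard = M'.eRk W + 4) → M'.E.encard = M'.eRank + 6 → ∀ e' ∈ M'.E,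
      {C : Set α | M'.IsCircuit C ∧ C.ncard = 5 ∧ e' ∈ C}.ncard ≤ 43 := by
    intro M' _ hfree' hns' hd' e' _
    have h := ncard_fiveCircuitsThrough_le_max_of_planePoor_table_six M' hfree' hns' hd' e' tPoorSix ht' 43
      (fun M'' _ hfree'' hns'' hd'' _ _ hX4 heX h7 =>
        (ncard_fiveCircuitsThrough_le_of_seven_solid_six_of_five M'' hfree'' hns'' hd'' hX4 heX h7 28 hq₅).trans
          (le_of_eq (by decide)))
    rw [capSum_tPoorSix_six] at h
    exact h.trans (le_of_eq (by decide))
  have h := ncard_fiveCircuits_le_mul_div_spread_of M hfree hns (d := 6) (by rw [hd]; norm_num) hn hn5 hK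
    (B := 21 + 18 + 28 + 43)
    (fun M' _ hfree' hns' hd' => ncard_fiveCircuits_le_of_perPoint_four_five_six M' hfree' hns' hd' 18 28 43 hq₄ hq₅ hq₆)
  simpa using h

end S1

end PercRepro
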